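import Literature.Computability.Complexity.UniformDerandomizationRandAlgProofs
import Literature.Computability.Complexity.UniformDerandomizationTestSampler
import Literature.Computability.Complexity.BoundedQuantifiersSubexp
import HarnessLib

/-!
# Impagliazzo–Wigderson 1998: both cases of the printed proof reduced to GENERATOR statements

Sibling proof file of `UniformDerandomizationRandAlg.lean` (named fact `impagliazzoWigderson1998`,
van Melkebeek 2000, Thm. 6.2.1 = Impagliazzo–Wigderson, JCSS 2001, Thm. 5). With
`UniformDerandomizationRandAlgProofs.lean` (the case split of IW §2.1: `impagliazzoWigderson1998_of_cases`),
`UniformDerandomizationDistinguishers.lean` / `UniformDerandomizationTestSampler.lean` (IW Lemma 13: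
failure of the simulation yields a PPT sampler of distinguishing tests) and
`BoundedQuantifiersSubexp.lean` (the majority-vote simulation `majSim` is in `DTIME[2^{n^ε}]`),
this file assembles IW's §2.1 completely: each of the two cases of the theorem now follows from a
statement about PSEUDORANDOM GENERATORS ONLY, in the tree's vocabulary —

* **Case 2 (`EXP ⊆ P/poly`; IW Lemmas 11–17 + §2.3):** `IWUniform.UniformPRGAt ε q` — for the
  coin polynomial `q` of the `BPP` witness there is a generator family `g` with seeds of length
  `k(n) = O(m^p)`, `m = ⌊n^{2^{-j}}⌋`, `p·2^{-j} < ε`, an `FP` producer of `0^{k n}`, matrices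
  `{⟨x, s⟩ | ⟨x, g_{|x|}(s)⟩ ∈ L'}` decidable in time `2^{O(m^p)}·poly` for every `L' ∈ P`, which
  **io-fools every weakly PPT-constructible family of one-sided tests** (`IWUniform.IOFools`: for
  every `L'' ∈ P`, every PPT index sampler `R` and every `c`, infinitely often
  `Pr[R(1^m) ∈ D_m^{g_m,1/4}] < m^{−c}`). This is exactly what IW prove from `EXP ⊆ P/poly` and
  `EXP ≠ BPP` (a downward- and random-self-reducible `EXP`-complete `f`, the NW/XOR generator `G_f`,
  Lemmas 13–17: were the distinguishers weakly constructible a.e., `f ∈ BPP`). From it: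
  `IWUniform.ioHeur_of_uniformPRG` (the conclusion of Thm. 6.2.1 for `A`) and
  **`impagliazzoWigderson1998_case2_of_uniformPRG`**.
* **Case 1 (`EXP ⊄ P/poly`; Babai–Fortnow–Nisan–Wigderson 1993):** `IWUniform.IOPRGAt ε q` — the
  same data, io-fooling NON-uniformly all the tests `T_{x} = {r | ⟨x, r⟩ ∈ L'}`, `|x| = n`, with
  error `< 1/6` at infinitely many lengths `n` (BFNW's generator from an `EXP`-function without
  polynomial-size circuits: van Melkebeek Thm. 2.3.7 / IKW Thm. 11 in the i.o. form). From it: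
  `IWUniform.mem_io_DTIME_of_ioPRG` (`A ∈ io-DTIME(2^{n^ε})`, Arora–Barak Lemma 20.3 at the i.o.
  lengths) and **`impagliazzoWigderson1998_case1_of_ioPRG`**.
* **`impagliazzoWigderson1998_of_generators`** — the fact from the two generator statements (and
  `impagliazzoWigderson1998_samplable_of_generators`, the equivalent rendering of
  `UniformDerandomization.lean`, through `UniformDerandomizationEquiv.lean`).

No named fact is introduced (D-0026): `UniformPRGAt`, `IOPRGAt`, `IOFools` are parametrised
predicates, the hypotheses of proved theorems; they are the remaining obligations of the discharge,
i.e. IW's main technical theorem (§2.2–2.4) and BFNW's theorem, both generator constructions.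

## References

* [ImpagliazzoWigderson2001] JCSS 63 (2001) 672–688: Thm. 5, §2.1 (simulation; "we can assume
  `EXP ⊂ P/poly`"), Def. 3, Lemmas 13 and 17 (held text pp. 5–7).
* [VanMelkebeek2000] LNCS 1950: Thm. 6.2.1 (p. 142), Thm. 2.3.7 (p. 37, the BFNW generator).
* [AroraBarakCC2009] CUP 2009: Lemma 20.3 and its proof (majority over all seeds; the `1/6` gap),
  Thm. 7.10 (error reduction), §20.1.
* L. Babai, L. Fortnow, N. Nisan, A. Wigderson, Comput. Complexity 3 (1993) 307–318 (cited through
  IW §2.1; not held).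
-/

noncomputable section

namespace Literature.Computability.Complexity

open _root_.Computability Filter Polynomial Brick MetaComplexity

namespace IWUniform

/-! ### From a `bpErr` witness to the one-sided error bounds -/

/-- A witness with two-sided error `≤ η` accepts members with probability `≥ 1 − η` and
non-members with probability `≤ η` (`IWUniform.truth`). [cite: AroraBarakCC2009, §7.4.1] -/
theorem truth_bounds_of_bpErr {A L' : Language Bool} {q : Polynomial ℕ} {η : ℝ}
    (h : ∀ x : List Bool,
      uniformProb (q.eval x.length) {y : List Bool | ¬ (boolPair x y ∈ L' ↔ x ∈ A)} ≤ η)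
    (x : List Bool) :
    (x ∈ A → 1 - η ≤ truth L' (q.eval x.length) x) ∧ (x ∉ A → truth L' (q.eval x.length) x ≤ η) := by
  constructor
  · intro hx
    have h1 := h x
    have e : {y : List Bool | ¬ (boolPair x y ∈ L' ↔ x ∈ A)} = {y : List Bool | boolPair x y ∈ L'}ᶜ := by
      ext y; simp [hx]
    rw [e, uniformProb_compl] at h1
    rw [truth]
    linarith
  · intro hx
    have h1 := h x
    have e : {y : List Bool | ¬ (boolPair x y ∈ L' ↔ x ∈ A)} = {y : List Bool | boolPair x y ∈ L'} := by
      ext y; simp [hx]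
    rw [e] at h1
    exact h1

/-! ### The matrix clause from a generator machine -/

/-- **Deciding the matrix from a generator machine.** If a machine maps every word `w` to the
re-paired word `⟨fstP w, g_{|fstP w|}(sndP w)⟩` within `tG n N` steps (`n = |fstP w|`, `N = |w|`),
then for every `L' ∈ P` the matrix `{⟨x, s⟩ | ⟨x, g_{|x|}(s)⟩ ∈ L'}` is decided one level up within
`tG n N + c (N + D · tG n N)^d + c` steps (run the generator, then the polynomial-time decider of
`L'` on its output, whose length is at most `N + D · tG n N`). [cite: AroraBarakCC2009, §1.3 (composition)] -/
theorem matrix_decIn_of_machine {g : ℕ → List Bool → List Bool} {tG : ℕ → ℕ → ℕ}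
    (hG : ∃ MG : Turing.TM2ComputableAux Bool Bool, ∀ w : List Bool,
      MG.OutputsWithin w (boolPair (fstP w) (g (fstP w).length (sndP w))) (tG (fstP w).length w.length))
    {L' : Language Bool} (hL' : L' ∈ Classes.P) :
    ∃ D c d : ℕ, NKannan.DecIn 1 (matrix L' g) fun n N => (c * (N + D * tG n N) ^ d + c) + tG n N := by
  obtain ⟨MG, hMG⟩ := hG
  obtain ⟨c, d, MA, hMA⟩ := NKannan.DecIn.of_mem_P hL' 0
  refine ⟨TM2Comp.machinePushBound MG.tm, c, d, MG.comp MA, fun w => ?_⟩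
  have h1 := hMG w
  have hlen := h1.length_le
  have h2 := hMA (boolPair (fstP w) (g (fstP w).length (sndP w)))
  simp only [id_eq] at h2
  have hind : Set.boolIndicator L' (boolPair (fstP w) (g (fstP w).length (sndP w))) =
      Set.boolIndicator (matrix L' g) w := by
    rcases Bool.eq_false_or_eq_true (Set.boolIndicator (matrix L' g) w) with h | h
    · rw [h]
      exact (Set.mem_iff_boolIndicator _ _).1 ((Set.mem_iff_boolIndicator _ _).2 h)
    · rw [h]
      exact (Set.notMem_iff_boolIndicator _ _).1 ((Set.notMem_iff_boolIndicator _ _).2 h)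
  rw [hind] at h2
  refine (Turing.TM2ComputableAux.comp_outputsWithin _ _ h1 h2).mono ?_
  show c * (boolPair (fstP w) (g (fstP w).length (sndP w))).length ^ d + c + tG (fstP w).length w.length ≤
    c * (w.length + TM2Comp.machinePushBound MG.tm * tG (fstP w).length w.length) ^ d + c +
      tG (fstP w).length w.length
  have := Nat.pow_le_pow_left hlen d
  nlinarith

/-- **The matrix clause of `UniformPRGAt` / `IOPRGAt` from a generator machine** whose running time
on the entries `⟨x, s⟩` (`|x| = n`, `|s| = k n`) is `2^{O(m^p)} · poly(n)`: every `L' ∈ P` then has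
its matrix decided in such a time (`NKannan.EBnd` bookkeeping). [cite: AroraBarakCC2009, §1.3] -/
theorem matrix_clause_of_machine {g : ℕ → List Bool → List Bool} {tG : ℕ → ℕ → ℕ} {k : ℕ → ℕ}
    {p j : ℕ}
    (hG : ∃ MG : Turing.TM2ComputableAux Bool Bool, ∀ w : List Bool,
      MG.OutputsWithin w (boolPair (fstP w) (g (fstP w).length (sndP w))) (tG (fstP w).length w.length))
    (hkK : ∃ K, ∀ n, k n ≤ K * (Nat.sqrt^[j] n) ^ p + K)
    (htG : NKannan.EBnd p j fun n => tG n (2 * n + 2 + k n)) {L' : Language Bool}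
    (hL' : L' ∈ Classes.P) :
    ∃ t : ℕ → ℕ → ℕ, NKannan.DecIn 1 (matrix L' g) t ∧ NKannan.EBnd p j fun n => t n (2 * n + 2 + k n) := by
  obtain ⟨D, c, d, hdec⟩ := matrix_decIn_of_machine hG hL'
  refine ⟨_, hdec, ?_⟩
  obtain ⟨K, hK⟩ := hkK
  have bN : NKannan.EBnd p j fun n => 2 * n + 2 + k n :=
    (((NKannan.EBnd.const 2).mul NKannan.EBnd.self).add (NKannan.EBnd.const 2)).add
      (NKannan.EBnd.lin K hK)
  exact ((((NKannan.EBnd.const c).mul ((bN.add ((NKannan.EBnd.const D).mul htG)).pow d)).add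
    (NKannan.EBnd.const c)).add htG)

/-! ### Case 2: uniform pseudorandomness against weakly constructible tests -/

/-- **io-fooling every weakly PPT-constructible family of one-sided tests** (the negation of the
hypothesis of IW Lemma 17 / conclusion of Lemma 13, uniformly in the witness language): for every
`L'' ∈ P`, every PPT sampler `R` of test indices on `1^m` and every exponent `c`, for infinitely
many `m` the sampler hits the class `D_m^{g_m, 1/4}` of `1/4`-distinguishing one-sided tests
(`IWUniform.goodIdx`) with probability `< m^{−c}`.
[cite: ImpagliazzoWigderson2001, Lemmas 13 and 17 (their hypotheses, negated)] -/
def IOFools (g : ℕ → List Bool → List Bool) (k q : ℕ → ℕ) : Prop :=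
  ∀ L'' ∈ Classes.P, ∀ R : RandAlg ℕ (List Bool),
    R.IsPolyTime unaryEncodeNat (id : List Bool → List Bool) → ∀ c : ℕ,
      ∃ᶠ m : ℕ in atTop, R.pr unaryEncodeNat m (goodIdx L'' (g m) (k m) (q m) (1 / 4)) < 1 / (m : ℝ) ^ c

/-- **A uniformly pseudorandom generator at scale `ε` for output length `q`** (the object IW §2
constructs under `EXP ⊆ P/poly`, `EXP ≠ BPP`): a family `g` on seeds of length `k n = O(m^p)`,
`m = ⌊n^{2^{-j}}⌋` with `p · 2^{-j} < ε`, an `FP` producer of the seed range, matrices decidable in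
time `2^{O(m^p)} · poly` for every polynomial-time witness, io-fooling the weakly constructible
one-sided tests on `q(m)` coins. [cite: ImpagliazzoWigderson2001, §2.1–2.3 and Lemma 17] -/
def UniformPRGAt (ε : ℝ) (q : Polynomial ℕ) : Prop :=
  ∃ (g : ℕ → List Bool → List Bool) (k : ℕ → ℕ) (p j : ℕ),
    (p : ℝ) * (1 / 2 : ℝ) ^ j < ε ∧ NKannan.FPProducer k ∧
    (∃ K, ∀ n, k n ≤ K * (Nat.sqrt^[j] n) ^ p + K) ∧
    (∀ L' ∈ Classes.P, ∃ t : ℕ → ℕ → ℕ,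
      NKannan.DecIn 1 (matrix L' g) t ∧ NKannan.EBnd p j fun n => t n (2 * n + 2 + k n)) ∧
    IOFools g k fun m => q.eval m

/-- **The conclusion of Thm. 6.2.1 for `A` from a uniformly pseudorandom generator** (IW §2.1 with
Lemmas 13/17 read contrapositively): take a witness of error `≤ 1/4` (`BPP_subset_bpErr`), the
generator for its coin polynomial, and `B = majSim` (in `DTIME[2^{n^ε}]` by
`majSim_mem_DTIME_ceil_rpow`); if the conclusion failed for some `d` and `M`, the test-index
sampler `testSampler M` would hit `D^{g_m,1/4}` with probability `≥ m^{−d}/2` for all large `m`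
(`eventually_le_pr_testSampler_goodIdx`), contradicting `IOFools` with `c = d + 1`.
[cite: ImpagliazzoWigderson2001, §2.1 and Lemmas 13, 17] [cite: VanMelkebeek2000, Thm. 6.2.1 (p. 142)] -/
theorem ioHeur_of_uniformPRG {A : Language Bool} (hA : A ∈ BPP) {ε : ℝ}
    (hG : ∀ q : Polynomial ℕ, UniformPRGAt ε q) :
    ∃ B ∈ DTIME (fun n => 2 ^ ⌈(n : ℝ) ^ ε⌉₊), ∀ (d : ℕ) (M : RandAlg ℕ (List Bool)),
      M.IsPolyTime unaryEncodeNat (id : List Bool → List Bool) →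
      (∃ q : Polynomial ℕ, ∀ m, M.coinLen m = q.eval m) →
      (∀ m r, r.length = M.coinLen m → (M.run m r).length = m) →
      ∃ᶠ m : ℕ in atTop, 1 - 1 / (m : ℝ) ^ d < M.pr unaryEncodeNat m {x | x ∈ A ↔ x ∈ B} := by
  -- a witness with error `≤ 1/4`
  obtain ⟨L', hL', qA, hqA⟩ := BPP_subset_bpErr (by norm_num : (0 : ℝ) < 1 / 4) hA
  obtain ⟨g, k, p, j, hε, hk, hkK, hmat, hfool⟩ := hG qA
  obtain ⟨t, hdec, ht⟩ := hmat L' hL'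
  refine ⟨majSim L' g k, majSim_mem_DTIME_ceil_rpow hdec hk hkK ht hε, fun d M hM _ hlen => ?_⟩
  by_contra hfail
  have herr := truth_bounds_of_bpErr (A := A) (L' := L') (q := qA) (η := 1 / 4) hqA
  have hev := eventually_le_pr_testSampler_goodIdx (L' := L') (M := M) (g := g) (k := k)
    (q := fun n => qA.eval n) (η := 1 / 4) (d := d) hlen herr hfail
  have hfr := hfool L' hL' (testSampler M) (testSampler_isPolyTime hM) (d + 1)
  have hθ : (1 / 2 - 1 / 4 : ℝ) = 1 / 4 := by norm_num
  simp only [hθ] at hev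
  obtain ⟨m, hlt, hle, hm2⟩ := (hfr.and_eventually (hev.and (eventually_ge_atTop 2))).exists
  have hm : (2 : ℝ) ≤ m := by exact_mod_cast hm2
  have hpos : (0 : ℝ) < (m : ℝ) ^ d := by positivity
  have key : 1 / (m : ℝ) ^ d / 2 < 1 / (m : ℝ) ^ (d + 1) := hle.trans_lt hlt
  rw [pow_succ, div_div, div_lt_div_iff_of_pos_left one_pos (by positivity) (by positivity)] at key
  nlinarith

/-- **Case 2 of `impagliazzoWigderson1998` from uniformly pseudorandom generators**: if under
`EXP ⊆ P/poly` and `BPP ≠ EXP` there is, for every `ε > 0` and every output polynomial `q`, a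
uniformly pseudorandom generator at scale `ε` (IW Lemmas 11–17 with §2.3), then the fact holds
under `EXP ⊆ P/poly`. [cite: ImpagliazzoWigderson2001, Thm. 5, §2 (the case `EXP ⊂ P/poly`)] -/
theorem _root_.Literature.Computability.Complexity.impagliazzoWigderson1998_case2_of_uniformPRG
    (h : EXP ⊆ PPoly → BPP ≠ EXP → ∀ ε : ℝ, 0 < ε → ∀ q : Polynomial ℕ, UniformPRGAt ε q) :
    EXP ⊆ PPoly → impagliazzoWigderson1998 :=
  fun hP hne _A hA ε hε => ioHeur_of_uniformPRG hA (h hP hne ε hε)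

/-! ### Case 1: non-uniform pseudorandomness infinitely often -/

/-- **An i.o. pseudorandom generator at scale `ε` for output length `q`** (the object
Babai–Fortnow–Nisan–Wigderson construct from `EXP ⊄ P/poly`): the same data as `UniformPRGAt`,
fooling — at infinitely many lengths `n`, for ALL instances `x` of length `n` — the test
`r ↦ [⟨x, r⟩ ∈ L']` on `q(n)` coins with error `< 1/6`: `|vote − truth| < 1/6`.
[cite: VanMelkebeek2000, Thm. 2.3.7 (p. 37)] [cite: AroraBarakCC2009, Lemma 20.3] -/
def IOPRGAt (ε : ℝ) (L' : Language Bool) (q : Polynomial ℕ) : Prop :=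
  ∃ (g : ℕ → List Bool → List Bool) (k : ℕ → ℕ) (p j : ℕ),
    (p : ℝ) * (1 / 2 : ℝ) ^ j < ε ∧ NKannan.FPProducer k ∧
    (∃ K, ∀ n, k n ≤ K * (Nat.sqrt^[j] n) ^ p + K) ∧
    (∃ t : ℕ → ℕ → ℕ,
      NKannan.DecIn 1 (matrix L' g) t ∧ NKannan.EBnd p j fun n => t n (2 * n + 2 + k n)) ∧
    ∃ᶠ n : ℕ in atTop, ∀ x : List Bool, x.length = n →
      |vote L' (g n) (k n) x - truth L' (q.eval n) x| < 1 / 6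

/-- **`A ∈ io-DTIME(2^{n^ε})` from an i.o. pseudorandom generator for its witness** (Arora–Barak
Lemma 20.3 at the lengths where the generator fools the tests: a `2/3`–`1/3` gap survives an error
`< 1/6`, so the majority vote is correct on every instance of those lengths).
[cite: AroraBarakCC2009, Lemma 20.3 (proof)] [cite: VanMelkebeek2000, Thm. 2.3.7 (p. 37)] -/
theorem mem_io_DTIME_of_ioPRG {A L' : Language Bool} {q : Polynomial ℕ}
    (hw : ∀ x : List Bool, 2 / 3 ≤ uniformProb (q.eval x.length) {y : List Bool | boolPair x y ∈ L' ↔ x ∈ A})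
    {ε : ℝ} (hG : IOPRGAt ε L' q) : A ∈ io (DTIME fun n => 2 ^ ⌈(n : ℝ) ^ ε⌉₊) := by
  obtain ⟨g, k, p, j, hε, hk, hkK, ⟨t, hdec, ht⟩, hfool⟩ := hG
  refine ⟨majSim L' g k, majSim_mem_DTIME_ceil_rpow hdec hk hkK ht hε, hfool.mono ?_⟩
  intro n hn x hx
  have hfx := abs_sub_lt_iff.1 (hn x hx)
  rw [mem_majSim_iff, hx]
  by_cases hxA : x ∈ A
  · have h23 : 2 / 3 ≤ truth L' (q.eval n) x := by
      have := hw x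
      rw [hx] at this
      simpa only [truth, hxA, iff_true] using this
    have hgt : 1 / 2 < vote L' (g n) (k n) x := by linarith [hfx.2]
    exact ⟨fun _ => hgt, fun _ => hxA⟩
  · have h13 : truth L' (q.eval n) x ≤ 1 / 3 := by
      have := hw x
      rw [hx] at this
      simp only [hxA, iff_false, ← Set.compl_setOf, uniformProb_compl] at this
      rw [truth]
      linarith
    have hlt : vote L' (g n) (k n) x < 1 / 2 := by linarith [hfx.1]
    exact ⟨fun h' => absurd h' hxA, fun h' => absurd h' (not_lt.2 hlt.le)⟩

/-- **Case 1 of `impagliazzoWigderson1998` from i.o. pseudorandom generators** (IW §2.1, first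
paragraph, with BFNW's theorem in generator form): if under `EXP ⊄ P/poly` every polynomial-time
witness is fooled at every scale by an i.o. generator, then `BPP ⊆ io-DTIME(2^{n^ε})` for every
`ε > 0`, the hypothesis `h₁` of `impagliazzoWigderson1998_of_cases`.
[cite: ImpagliazzoWigderson2001, §2.1, first paragraph] [cite: VanMelkebeek2000, Thm. 2.3.7 (p. 37)] -/
theorem _root_.Literature.Computability.Complexity.impagliazzoWigderson1998_case1_of_ioPRG
    (h : ¬ EXP ⊆ PPoly → ∀ ε : ℝ, 0 < ε → ∀ L' ∈ Classes.P, ∀ q : Polynomial ℕ, IOPRGAt ε L' q) :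
    ¬ EXP ⊆ PPoly → ∀ ε : ℝ, 0 < ε → BPP ⊆ io (DTIME fun n => 2 ^ ⌈(n : ℝ) ^ ε⌉₊) := by
  intro hP ε hε A hA
  obtain ⟨L', hL', q, hq⟩ := hA
  exact mem_io_DTIME_of_ioPRG hq (h hP ε hε L' hL' q)

/-- **`impagliazzoWigderson1998` from the two generator constructions** of its printed proof:
BFNW's i.o. generator under `EXP ⊄ P/poly` (Case 1) and IW's uniformly pseudorandom generator
under `EXP ⊆ P/poly`, `BPP ≠ EXP` (Case 2), through `impagliazzoWigderson1998_of_cases`.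
[cite: ImpagliazzoWigderson2001, Thm. 5 and §2.1] [cite: VanMelkebeek2000, Thm. 6.2.1 (p. 142)] -/
theorem _root_.Literature.Computability.Complexity.impagliazzoWigderson1998_of_generators
    (h₁ : ¬ EXP ⊆ PPoly → ∀ ε : ℝ, 0 < ε → ∀ L' ∈ Classes.P, ∀ q : Polynomial ℕ, IOPRGAt ε L' q)
    (h₂ : EXP ⊆ PPoly → BPP ≠ EXP → ∀ ε : ℝ, 0 < ε → ∀ q : Polynomial ℕ, UniformPRGAt ε q) :
    impagliazzoWigderson1998 :=
  impagliazzoWigderson1998_of_cases (impagliazzoWigderson1998_case1_of_ioPRG h₁)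
    (impagliazzoWigderson1998_case2_of_uniformPRG h₂)

/-- The same two generator constructions discharge the tree's rendering
`impagliazzoWigderson1998_samplable` (`UniformDerandomization.lean`) as well, the two facts being
equivalent (`impagliazzoWigderson1998_samplable_of_printed`, `UniformDerandomizationEquiv.lean`).
[cite: VanMelkebeek2000, Thm. 6.2.1 (p. 142)] -/
theorem _root_.Literature.Computability.Complexity.impagliazzoWigderson1998_samplable_of_generators
    (h₁ : ¬ EXP ⊆ PPoly → ∀ ε : ℝ, 0 < ε → ∀ L' ∈ Classes.P, ∀ q : Polynomial ℕ, IOPRGAt ε L' q)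
    (h₂ : EXP ⊆ PPoly → BPP ≠ EXP → ∀ ε : ℝ, 0 < ε → ∀ q : Polynomial ℕ, UniformPRGAt ε q) :
    impagliazzoWigderson1998_samplable :=
  impagliazzoWigderson1998_samplable_of_printed (impagliazzoWigderson1998_of_generators h₁ h₂)

end IWUniform

end Literature.Computability.Complexity

end
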